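import Literature.Computability.Complexity.UniformDerandomizationEquiv
import HarnessLib

/-!
# A PPT sampler on `1^m` may be assumed to toss EXACTLY polynomially many coins (guess the budget)

Literature / complexity toolkit, companion of `UniformDerandomizationEquiv.lean`. There the
uniform sampler `UDerand.mixSampler S p` guesses the (polynomially bounded, otherwise arbitrary)
coin budget `S.coinLen m ≤ p(m)` of a PPT sampler `S` from `L(m) = |bin p(m)| + 1` extra coins, runs
`S` on that many coins and PADS the output to length `m`; it loses only the factor
`2^{-L(m)} ≥ 1/(4 p(m) + 4)` on every event (`pr_mixSampler_ge`, for length-preserving `S`). This file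
records the same trick WITHOUT the padding, for samplers of arbitrary strings (test indices,
circuit descriptions): `UDerand.guessSampler S p` (its string function is the tree's `UDerand.xF'`),

* `guessSampler_coinLen_eq` (exact budget `2p + 1`), `xF'_boolPair`, `xF'_mem_FP`,
  `guessSampler_isPolyTime`;
* `pr_guessSampler_ge` — `Pr_r[guess(1^m; r) ∈ E] ≥ 2^{-L(m)} · Pr_u[S(1^m; u) ∈ E]` for EVERY event;
* **`exists_exactBudget_of_hits`** — if a PPT `R` hits the sets `A n` with probability `≥ n^{-c}`
  for all large `n`, then some PPT `R'` with an EXACTLY polynomial coin budget hits them with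
  probability `≥ n^{-c'}` for all large `n` (`c' = c + k_p + 1`). Hence a WEAK probabilistic
  construction in the sense of Impagliazzo–Wigderson 1998, §2.2 (`IWUniform.WeaklyConstructible`,
  polynomially BOUNDED budget, the negation of `IWUniform.IOFools`) may be assumed to have an exact
  polynomial budget — the form in which a strong construction cuts its coin string into blocks
  (Lemma 14).

Everything is proved; the only definition is the sampler.

## References

* [ImpagliazzoWigderson2001] JCSS 63 (2001), §2.2 (weak constructions) and Lemma 14.
* [TrevisanVadhan2007] Comput. Complexity 16 (2007), §2.1 (the quantifier bookkeeping of uniform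
  samplers), as in `UniformDerandomizationEquiv.lean`.
* [AroraBarakCC2009] CUP 2009, §7.1, Def. 7.3 (coins as input).
-/

noncomputable section

namespace Literature.Computability.Complexity

open _root_.Computability Finset Filter Polynomial Brick Plumb

namespace UDerand

section Guess

variable (S : RandAlg ℕ (List Bool)) (p : Polynomial ℕ)

/-- **The budget-guessing sampler** (no padding): with coins `r` (exactly `2 p(m) + 1` of them) on
`1^m`, read `v = ⟦r ↾ L(m)⟧`, set `j = min(v, p(m))` and output `S(1^m; ·)` run on the next `j`
coins. [folklore] -/
def guessSampler : RandAlg ℕ (List Bool) where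
  run m r := S.run m ((r.drop (guessLen p m)).take (min (bitsToNat (r.take (guessLen p m))) (p.eval m)))
  coinLen m := (2 * p + 1).eval m

/-- `guess` tosses exactly `(2p + 1)(m)` coins. [folklore] -/
theorem guessSampler_coinLen_eq : ∀ m, (guessSampler S p).coinLen m = (2 * p + 1).eval m := fun _ => rfl

/-- `|1^m| = m` (the copy in the companion file is private). [folklore] -/
private theorem length_unaryEncodeNat' (m : ℕ) : (unaryEncodeNat m).length = m := by
  rw [OracleCompose.unaryEncodeNat_eq_replicate, List.length_replicate]

/-- **Value of the unpadded string function `xF'`** on `⟨1^m, r⟩`: the run of `guess`. [folklore] -/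
theorem xF'_boolPair (m : ℕ) (r : List Bool) :
    xF' S p (boolPair (unaryEncodeNat m) r) = (guessSampler S p).run m r := by
  have hm : (unaryEncodeNat m).length = m := length_unaryEncodeNat' m
  obtain ⟨j, hjdef⟩ : ∃ j, j = min (bitsToNat (r.take (guessLen p m))) (p.eval m) := ⟨_, rfl⟩
  have hP : PUF p (boolPair (unaryEncodeNat m) r) = ones (p.eval m) := by
    simp only [PUF, Function.comp_apply, fstF_boolPair, polyFn_apply, hm]
  have hL : LUF p (boolPair (unaryEncodeNat m) r) = ones (guessLen p m) := by
    simp only [LUF, Function.comp_apply, hP, lenBinF_apply, onesFn]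
    rw [OracleCompose.unaryEncodeNat_eq_replicate, guessLen]
    simp [ones, List.replicate_succ]
  have hj : jUF p (boolPair (unaryEncodeNat m) r) = ones j := by
    simp only [jUF, Function.comp_apply, fanoutFn_apply, hP, hL, takeFn_boolPair, sndF_boolPair,
      binToUnaryFn_boolPair, hjdef]
    simp [ones]
  have hu : uF' p (boolPair (unaryEncodeNat m) r) = (r.drop (guessLen p m)).take j := by
    simp only [uF', Function.comp_apply, fanoutFn_apply, hj, hL, takeFn_boolPair, dropFn_boolPair, sndF_boolPair]
    simp [ones]
  have hrun : (guessSampler S p).run m r = S.run m ((r.drop (guessLen p m)).take j) := by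
    dsimp only [guessSampler]
    rw [← hjdef]
  rw [hrun]
  simp only [xF', Function.comp_apply, fanoutFn_apply, fstF_boolPair, hu, sampleFn, sndF_boolPair, hm]

variable {S}

/-- `xF' ∈ FP` for a PPT sampler (the five stages of the companion file). [cite: AroraBarakCC2009, §1.3 (composition)] -/
theorem xF'_mem_FP (hS : S.IsPolyTime unaryEncodeNat (id : List Bool → List Bool)) : xF' S p ∈ FP := by
  have hP : PUF p ∈ FP := comp_mem_FP (polyFn_mem_FP p) fstF_mem_FP
  have hL : LUF p ∈ FP :=
    comp_mem_FP (cons_mem_FP true) (comp_mem_FP onesFn_mem_FP (comp_mem_FP lenBinF_mem_FP hP))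
  have hj : jUF p ∈ FP :=
    comp_mem_FP binToUnaryFn_mem_FP (fanoutFn_mem_FP hP (comp_mem_FP takeFn_mem_FP (fanoutFn_mem_FP hL sndF_mem_FP)))
  have hu : uF' p ∈ FP :=
    comp_mem_FP takeFn_mem_FP (fanoutFn_mem_FP hj (comp_mem_FP dropFn_mem_FP (fanoutFn_mem_FP hL sndF_mem_FP)))
  exact comp_mem_FP (sampleFn_mem_FP hS) (fanoutFn_mem_FP fstF_mem_FP hu)

/-- **`guess` is a PPT sampler** with the exact budget `2p + 1`. [cite: AroraBarakCC2009, Def. 7.3] -/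
theorem guessSampler_isPolyTime (hS : S.IsPolyTime unaryEncodeNat (id : List Bool → List Bool)) :
    (guessSampler S p).IsPolyTime unaryEncodeNat (id : List Bool → List Bool) := by
  refine ⟨?_, ⟨2 * p + 1, fun n => le_rfl⟩⟩
  obtain ⟨q, M, hM⟩ := xF'_mem_FP p hS
  refine ⟨q, M, fun z => ?_⟩
  have := hM (boolPair (unaryEncodeNat z.1) z.2)
  rwa [id, xF'_boolPair] at this

variable (S)

/-- **Guessing the budget costs a factor `2^{-L(m)}`** (no padding, every event): if `S` uses
`c ≤ p(m)` coins on `1^m`, then `Pr_r[guess(1^m; r) ∈ E] ≥ 2^{-L(m)} · Pr_u[S(1^m; u) ∈ E]`.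
[folklore] -/
theorem pr_guessSampler_ge (m : ℕ) (hc : S.coinLen m ≤ p.eval m) (E : Set (List Bool)) :
    uniformProb (S.coinLen m) {u | S.run m u ∈ E} / 2 ^ guessLen p m ≤
      uniformProb ((2 * p + 1).eval m) {r | (guessSampler S p).run m r ∈ E} := by
  have hcL : S.coinLen m < 2 ^ guessLen p m := by
    rw [guessLen]
    calc S.coinLen m ≤ p.eval m := hc
      _ = bitsToNat (encodeNat (p.eval m)) := (bitsToNat_encodeNat _).symm
      _ < 2 ^ (encodeNat (p.eval m)).length := bitsToNat_lt _
      _ ≤ 2 ^ ((encodeNat (p.eval m)).length + 1) := Nat.pow_le_pow_right two_pos (Nat.le_succ _)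
  obtain ⟨e, he⟩ : ∃ e, (2 * p + 1).eval m = guessLen p m + (S.coinLen m + e) := by
    refine ⟨(2 * p + 1).eval m - guessLen p m - S.coinLen m, ?_⟩
    have hLP : guessLen p m ≤ p.eval m + 1 := by
      rw [guessLen, TM2Pass.length_encodeNat_eq_size]
      have : (p.eval m).size ≤ p.eval m := by
        rcases Nat.eq_zero_or_pos (p.eval m) with h0 | hpos
        · rw [h0]; rfl
        · exact Nat.size_le.2 Nat.lt_two_pow_self
      omega
    have : (2 * p + 1).eval m = 2 * p.eval m + 1 := by simp
    omega
  rw [he]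
  have hsub : cnt (guessLen p m + (S.coinLen m + e))
      {r | r.take (guessLen p m) = natBits (guessLen p m) (S.coinLen m) ∧
        (r.drop (guessLen p m)).take (S.coinLen m) ∈ {u | S.run m u ∈ E}} ≤
      cnt (guessLen p m + (S.coinLen m + e)) {r | (guessSampler S p).run m r ∈ E} := by
    classical
    unfold cnt
    refine card_le_card fun r hr => ?_
    simp only [mem_filter, mem_univ, true_and, Set.mem_setOf_eq] at hr ⊢
    obtain ⟨h1, h2⟩ := hr
    have hj : min (bitsToNat (r.toList.take (guessLen p m))) (p.eval m) = S.coinLen m := by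
      rw [h1, bitsToNat_natBits hcL, min_eq_left hc]
    have hrun : (guessSampler S p).run m r.toList = S.run m ((r.toList.drop (guessLen p m)).take (S.coinLen m)) := by
      dsimp only [guessSampler]
      rw [hj]
    rw [hrun]
    exact h2
  have h := cnt_guess (guessLen p m) (S.coinLen m) e {u | S.run m u ∈ E}
  have hsub' : ((cnt (S.coinLen m) {u | S.run m u ∈ E} * 2 ^ e : ℕ) : ℝ) ≤
      cnt (guessLen p m + (S.coinLen m + e)) {r | (guessSampler S p).run m r ∈ E} := by
    rw [← h]; exact_mod_cast hsub
  push_cast at hsub'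
  rw [uniformProb_eq_cnt_div, uniformProb_eq_cnt_div, div_div]
  have h2 : (2 : ℝ) ^ (guessLen p m + (S.coinLen m + e)) = 2 ^ S.coinLen m * 2 ^ guessLen p m * 2 ^ e := by
    rw [pow_add, pow_add]; ring
  have he0 : (2 : ℝ) ^ e ≠ 0 := pow_ne_zero _ two_ne_zero
  rw [h2, ← mul_div_mul_right _ (2 ^ S.coinLen m * 2 ^ guessLen p m) he0]
  exact div_le_div_of_nonneg_right hsub' (by positivity)

end Guess

/-- **Exact budgets for free**: a PPT sampler `R` on `1^n` hitting the sets `A n` with probability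
`≥ n^{-c}` for all large `n` yields a PPT sampler with an EXACTLY polynomial coin budget hitting them
with probability `≥ n^{-c'}` for all large `n` — so a weak probabilistic construction (IW §2.2,
polynomially bounded coins) may be assumed to toss exactly `q(n)` coins.
[cite: ImpagliazzoWigderson2001, §2.2 (weak construction)] [cite: TrevisanVadhan2007, §2.1] -/
theorem exists_exactBudget_of_hits {A : ℕ → Set (List Bool)} {R : RandAlg ℕ (List Bool)}
    (hR : R.IsPolyTime unaryEncodeNat (id : List Bool → List Bool)) {c : ℕ}
    (hhit : ∀ᶠ n : ℕ in atTop, 1 / (n : ℝ) ^ c ≤ R.pr unaryEncodeNat n (A n)) :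
    ∃ R' : RandAlg ℕ (List Bool), R'.IsPolyTime unaryEncodeNat (id : List Bool → List Bool) ∧
      (∃ q : Polynomial ℕ, ∀ m, R'.coinLen m = q.eval m) ∧
      ∃ c' : ℕ, ∀ᶠ n : ℕ in atTop, 1 / (n : ℝ) ^ c' ≤ R'.pr unaryEncodeNat n (A n) := by
  obtain ⟨p, hp⟩ := hR.2
  obtain ⟨cp, kp, hcp⟩ := exists_eval_le_mul_pow_add p
  refine ⟨guessSampler R p, guessSampler_isPolyTime p hR, ⟨2 * p + 1, guessSampler_coinLen_eq R p⟩,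
    c + kp + 1, ?_⟩
  filter_upwards [hhit, eventually_ge_atTop (8 * cp + 8)] with m hm hm8
  have hm1 : 1 ≤ m := by omega
  have hmR : (1 : ℝ) ≤ m := by exact_mod_cast hm1
  -- the hit probability of `R` in counting form
  have hR' : R.pr unaryEncodeNat m (A m) = uniformProb (R.coinLen m) {u | R.run m u ∈ A m} := by
    rw [RandAlg.pr_eq_uniformProb, OracleCompose.unaryEncodeNat_eq_replicate, List.length_replicate]
  have hG' : (guessSampler R p).pr unaryEncodeNat m (A m) =
      uniformProb ((2 * p + 1).eval m) {r | (guessSampler R p).run m r ∈ A m} := by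
    rw [RandAlg.pr_eq_uniformProb, OracleCompose.unaryEncodeNat_eq_replicate, List.length_replicate]
    rfl
  have hmix := pr_guessSampler_ge R p m (hp m) (A m)
  rw [← hR'] at hmix
  rw [hG']
  -- arithmetic: `1/m^{c+kp+1} ≤ (1/m^c) / 2^L ≤ Pr_R / 2^L ≤ Pr_guess`
  have h2L : (2 : ℝ) ^ guessLen p m ≤ 4 * (((p.eval m : ℕ) : ℝ) + 1) := by
    have := two_pow_length_encodeNat_succ_le (p.eval m)
    rw [guessLen]; exact_mod_cast this
  have h4P : 4 * (((p.eval m : ℕ) : ℝ) + 1) ≤ (m : ℝ) ^ (kp + 1) := by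
    have h1 : p.eval m ≤ cp * m ^ kp + cp := hcp m
    have h2 : 1 ≤ m ^ kp := Nat.one_le_pow _ _ hm1
    have h3 : 4 * (p.eval m + 1) ≤ m ^ (kp + 1) := by
      calc 4 * (p.eval m + 1) ≤ 4 * (cp * m ^ kp + cp + 1) := by omega
        _ ≤ (8 * cp + 8) * m ^ kp := by nlinarith
        _ ≤ m * m ^ kp := Nat.mul_le_mul_right _ hm8
        _ = m ^ (kp + 1) := by ring
    exact_mod_cast h3
  have hpos : (0 : ℝ) < (m : ℝ) ^ c := by positivity
  have hL0 : (0 : ℝ) < 2 ^ guessLen p m := by positivity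
  have hstep : 1 / (m : ℝ) ^ (c + kp + 1) ≤ (1 / (m : ℝ) ^ c) / 2 ^ guessLen p m := by
    rw [div_div]
    apply one_div_le_one_div_of_le (by positivity)
    calc (m : ℝ) ^ c * 2 ^ guessLen p m ≤ (m : ℝ) ^ c * (m : ℝ) ^ (kp + 1) :=
          mul_le_mul_of_nonneg_left (h2L.trans h4P) hpos.le
      _ = (m : ℝ) ^ (c + kp + 1) := by rw [← pow_add, add_assoc]
  calc 1 / (m : ℝ) ^ (c + kp + 1) ≤ (1 / (m : ℝ) ^ c) / 2 ^ guessLen p m := hstep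
    _ ≤ R.pr unaryEncodeNat m (A m) / 2 ^ guessLen p m := by gcongr
    _ ≤ _ := hmix

end UDerand

end Literature.Computability.Complexity

end
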